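import Summits.AtomisticToContinuum.BoseEinsteinCondensation.Theorems.BECCutLineWeakDisorderWitnessTransferCoreEntry
import Literature.MathematicalPhysics.QuantumManyBody.GroundStateFeynmanKacMarkov
import Literature.MathematicalPhysics.QuantumManyBody.GroundStateFeynmanKacGaussian
import Literature.Probability.Process.PoissonSuperposition
import Mathlib.Probability.BrownianMotion.Basic
import HarnessLib

/-!
# Route BECCutLineWeakDisorder — `WitnessTransfer`, occupation estimate at a coincidence point I:
# the pair difference of two world-lines

Support file (does not close the item) for item stmt-AtomisticToContinuum-14978
(`Summit.AtomisticToContinuum.BoseEinsteinCondensation.Theses.BECCutLineWeakDisorder`, decl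
`WitnessTransfer`), stub (S8) `stub_threeDim_occupation_pz` of line `Sketch`. For two world-lines
`Bⁱ, Bʲ` (`i ≠ j`) started at the same point, the pair difference
`Z_t = Bⁱ_t − Bʲ_t = √2 (b_t(ω i ·) − b_t(ω j ·)) ∈ ℝ³` under `wienerPaths N` is a Brownian motion
run at speed `4`:

* `pairDiff_apply`, `pairDiff_eq_toLp` — coordinates;
* `map_pairDiff_coord`, `iIndepFun_pairDiff_coord`, `map_pairDiff` — at time `t > 0` the three
  coordinates are independent `N(0, 4t)`, so `Z_t` has the density `∏_k φ_{4t}(y_k)`, i.e.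
  `(8πt)^{-3/2} e^{-|y|²/(8t)}` (`prod_gaussianPDF_four_eq`, `lintegral_pairDiff_eq`);
* `lintegral_pairDiff_mul_shift` — the Markov factorisation
  `E[F(Z_s) H(Z_{s+τ})] = E[F(Z_s) E'[H(Z_s + Z'_τ)]]` (weak Markov property of the `3N` Brownian
  coordinates, `lintegral_comp_pathsShift_eq`).

## References

* D. Revuz, M. Yor, *Continuous Martingales and Brownian Motion* (1999), Ch. I Ex. (1.11),
  Ch. III §1. [RevuzYor1999]
* K. L. Chung, Z. Zhao, *From Brownian Motion to Schrödinger's Equation* (1995), (1.11), §3.2.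
  [ChungZhao1995]
-/

noncomputable section

open MeasureTheory ProbabilityTheory Filter Set Metric
open scoped ENNReal NNReal Topology

namespace Summit.AtomisticToContinuum.BoseEinsteinCondensation.Theorems.CutLineWitness

open Literature.MathematicalPhysics.QuantumManyBody.BoseGas
open Literature.Probability.Process
open Literature.MathematicalPhysics.QuantumFieldTheory.GaussianToolkit (map_withDensity_equiv)

variable {N : ℕ}

/-! ### Coordinates of the pair difference -/

/-- Coordinates of the pair difference from coincident starting points:
`(Bⁱ_t − Bʲ_t)_k = √2 (b_t(ω i k) − b_t(ω j k))` (`xᵢ = xⱼ`). [folklore] -/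
theorem pairDiff_apply {X : Config N} {i j : Fin N} (hX : X i = X j) (ω : PathSpace N) (t : ℝ≥0)
    (k : Fin 3) :
    (worldLine X ω t i - worldLine X ω t j) k =
      Real.sqrt 2 * (brownian t (ω i k) - brownian t (ω j k)) := by
  rw [PiLp.sub_apply, worldLine_apply_apply, worldLine_apply_apply, hX]
  ring

/-- The pair difference from coincident starting points as a Euclidean vector:
`Bⁱ_t − Bʲ_t = √2 (b_t(ω i ·) − b_t(ω j ·))`. [folklore] -/
theorem pairDiff_eq_toLp {X : Config N} {i j : Fin N} (hX : X i = X j) (ω : PathSpace N)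
    (t : ℝ≥0) :
    worldLine X ω t i - worldLine X ω t j =
      WithLp.toLp 2 (fun k => Real.sqrt 2 * (brownian t (ω i k) - brownian t (ω j k))) := by
  ext k
  rw [pairDiff_apply hX, PiLp.toLp_apply]

/-- The coordinate map `ω ↦ √2 (b_t(ω i k) − b_t(ω j k))` is measurable. [folklore] -/
@[fun_prop]
theorem measurable_pairDiff_coord (i j : Fin N) (k : Fin 3) (t : ℝ≥0) :
    Measurable fun ω : PathSpace N => Real.sqrt 2 * (brownian t (ω i k) - brownian t (ω j k)) :=
  (((measurable_brownian t).comp ((measurable_pi_apply k).comp (measurable_pi_apply i))).sub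
    ((measurable_brownian t).comp ((measurable_pi_apply k).comp (measurable_pi_apply j)))).const_mul _

/-! ### The Gaussian law of the pair difference at a fixed time -/

/-- **Each coordinate of the pair difference at time `t` is `N(0, 4t)`**: `b_t(ω i k)` and
`−b_t(ω j k)` are independent `N(0, t)` (`i ≠ j`), their sum is `N(0, 2t)`, and `√2 ·` scales the
variance by `2`. [folklore] -/
theorem map_pairDiff_coord {i j : Fin N} (hij : i ≠ j) (k : Fin 3) (t : ℝ≥0) :
    (wienerPaths N).map
        (fun ω : PathSpace N => Real.sqrt 2 * (brownian t (ω i k) - brownian t (ω j k))) =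
      gaussianReal 0 (4 * t) := by
  have hmi : Measurable fun ω : PathSpace N => brownian t (ω i k) :=
    (measurable_brownian t).comp ((measurable_pi_apply k).comp (measurable_pi_apply i))
  have hmj : Measurable fun ω : PathSpace N => -brownian t (ω j k) :=
    ((measurable_brownian t).comp ((measurable_pi_apply k).comp (measurable_pi_apply j))).neg
  have hXlaw : (wienerPaths N).map (fun ω : PathSpace N => brownian t (ω i k)) =
      gaussianReal 0 t :=
    ((isPreBrownianReal_pathCoord i k).hasLaw_eval t).map_eq
  have hmj' : Measurable fun ω : PathSpace N => brownian t (ω j k) :=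
    (measurable_brownian t).comp ((measurable_pi_apply k).comp (measurable_pi_apply j))
  have hYlaw : (wienerPaths N).map (fun ω : PathSpace N => -brownian t (ω j k)) =
      gaussianReal 0 t := by
    calc (wienerPaths N).map (fun ω : PathSpace N => -brownian t (ω j k))
        = ((wienerPaths N).map (fun ω : PathSpace N => brownian t (ω j k))).map
            (fun x : ℝ => -x) := by
          rw [Measure.map_map measurable_neg hmj']
          rfl
      _ = gaussianReal 0 t := by
          rw [((isPreBrownianReal_pathCoord j k).hasLaw_eval t).map_eq, gaussianReal_map_neg,
            neg_zero]
  have hind : IndepFun (fun ω : PathSpace N => brownian t (ω i k))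
      (fun ω : PathSpace N => -brownian t (ω j k)) (wienerPaths N) := by
    have hne : ((i, k) : Fin N × Fin 3) ≠ (j, k) := fun h => hij (Prod.mk.inj h).1
    exact (iIndepFun_pathCoord.indepFun hne).comp (measurable_brownian t)
      (measurable_brownian t).neg
  have hsum := gaussianReal_add_gaussianReal_of_indepFun hind hXlaw hYlaw
  have h2 : (fun ω : PathSpace N => Real.sqrt 2 * (brownian t (ω i k) - brownian t (ω j k))) =
      (fun x : ℝ => Real.sqrt 2 * x) ∘ ((fun ω : PathSpace N => brownian t (ω i k)) +
        fun ω : PathSpace N => -brownian t (ω j k)) := by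
    funext ω
    simp [sub_eq_add_neg]
  rw [h2, ← Measure.map_map (measurable_const_mul _) (hmi.add hmj), hsum,
    gaussianReal_map_const_mul]
  congr 1
  · simp
  · ext
    push_cast
    rw [Real.sq_sqrt (by norm_num)]
    ring

/-- **The three coordinates of the pair difference are independent** (they are functions of the
disjoint groups `(ω i' k)_{i'}`, `k = 0, 1, 2`, of the independent path coordinates).
[folklore] -/
theorem iIndepFun_pairDiff_coord (i j : Fin N) (t : ℝ≥0) :
    iIndepFun (fun (k : Fin 3) (ω : PathSpace N) =>
      Real.sqrt 2 * (brownian t (ω i k) - brownian t (ω j k))) (wienerPaths N) := by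
  have h1 : iIndepFun (fun (q : Fin 3 × Fin N) (ω : PathSpace N) => ω q.2 q.1) (wienerPaths N) :=
    iIndepFun_pathCoord.precomp (g := (Prod.swap : Fin 3 × Fin N → Fin N × Fin 3))
      Prod.swap_injective
  have h2 : iIndepFun (fun (k : Fin 3) (ω : PathSpace N) => fun i' : Fin N => ω i' k)
      (wienerPaths N) :=
    iIndepFun_pi_of_prod (X := fun (k : Fin 3) (i' : Fin N) (ω : PathSpace N) => ω i' k)
      (fun k i' => (measurable_pi_apply k).comp (measurable_pi_apply i')) h1
  exact h2.comp (fun _ (col : Fin N → ℝ≥0 → ℝ) =>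
      Real.sqrt 2 * (brownian t (col i) - brownian t (col j)))
    fun _ => (((measurable_brownian t).comp (measurable_pi_apply i)).sub
      ((measurable_brownian t).comp (measurable_pi_apply j))).const_mul _

/-- **Law of the pair difference at time `t > 0` from coincident points**: the density
`y ↦ ∏_k φ_{4t}(y_k)` with respect to Lebesgue measure on `ℝ³` (`N(0, 4t I₃)`). [folklore] -/
theorem map_pairDiff {X : Config N} {i j : Fin N} (hij : i ≠ j) (hX : X i = X j) {t : ℝ≥0}
    (ht : t ≠ 0) :
    (wienerPaths N).map (fun ω : PathSpace N => worldLine X ω t i - worldLine X ω t j) =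
      (volume : Measure Space).withDensity fun y => ∏ k, gaussianPDF 0 (4 * t) (y k) := by
  have hv : (4 : ℝ≥0) * t ≠ 0 := mul_ne_zero four_ne_zero ht
  have hpi : (wienerPaths N).map (fun (ω : PathSpace N) (k : Fin 3) =>
      Real.sqrt 2 * (brownian t (ω i k) - brownian t (ω j k))) =
      Measure.pi fun _ : Fin 3 => gaussianReal 0 (4 * t) := by
    rw [(iIndepFun_iff_map_fun_eq_pi_map
      (fun k => (measurable_pairDiff_coord i j k t).aemeasurable)).1
      (iIndepFun_pairDiff_coord i j t)]
    congr 1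
    funext k
    exact map_pairDiff_coord hij k t
  have h : (fun ω : PathSpace N => worldLine X ω t i - worldLine X ω t j) =
      (MeasurableEquiv.toLp 2 (Fin 3 → ℝ)) ∘ fun (ω : PathSpace N) (k : Fin 3) =>
        Real.sqrt 2 * (brownian t (ω i k) - brownian t (ω j k)) := by
    funext ω
    rw [Function.comp_apply, MeasurableEquiv.coe_toLp]
    exact pairDiff_eq_toLp hX ω t
  rw [h, ← Measure.map_map (MeasurableEquiv.measurable _)
    (measurable_pi_lambda _ fun k => measurable_pairDiff_coord i j k t), hpi,
    pi_gaussianReal_eq_withDensity hv, map_withDensity_equiv, MeasurableEquiv.coe_toLp,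
    (PiLp.volume_preserving_toLp (Fin 3)).map_eq]
  rfl

/-- **The density of `N(0, 4t I₃)` in radial form**:
`∏_k φ_{4t}(y_k) = (√(8πt))⁻³ e^{-|y|²/(8t)}`. [folklore] -/
theorem prod_gaussianPDF_four_eq (t : ℝ≥0) (y : Space) :
    (∏ k, gaussianPDF 0 (4 * t) (y k)) =
      ENNReal.ofReal ((Real.sqrt (8 * Real.pi * t))⁻¹ ^ 3 *
        Real.exp (-‖y‖ ^ 2 / (8 * t))) := by
  simp only [gaussianPDF, gaussianPDFReal, sub_zero]
  rw [← ENNReal.ofReal_prod_of_nonneg (fun k _ => by positivity)]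
  congr 1
  rw [Finset.prod_mul_distrib, Finset.prod_const, Finset.card_univ, Fintype.card_fin,
    ← Real.exp_sum, EuclideanSpace.real_norm_sq_eq]
  congr 1
  · push_cast
    ring_nf
  · rw [neg_div, Finset.sum_div, ← Finset.sum_neg_distrib]
    refine congr_arg Real.exp (Finset.sum_congr rfl fun k _ => ?_)
    push_cast
    ring

/-- The radial density is measurable in the position. [folklore] -/
theorem measurable_prod_gaussianPDF_four (t : ℝ≥0) :
    Measurable fun y : Space => ∏ k, gaussianPDF 0 (4 * t) (y k) :=
  Finset.measurable_prod _ fun k _ => (measurable_gaussianPDF _ _).comp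
    ((measurable_pi_apply k).comp (WithLp.measurable_ofLp 2 _))

/-- **Expectations of the pair difference at time `t > 0`** (coincident start):
`E[F(Z_t)] = ∫ (√(8πt))⁻³ e^{-|y|²/(8t)} F(y) dy`. [folklore] -/
theorem lintegral_pairDiff_eq {X : Config N} {i j : Fin N} (hij : i ≠ j) (hX : X i = X j)
    {t : ℝ≥0} (ht : t ≠ 0) {F : Space → ℝ≥0∞} (hF : Measurable F) :
    ∫⁻ ω, F (worldLine X ω t i - worldLine X ω t j) ∂wienerPaths N =
      ∫⁻ y : Space, ENNReal.ofReal ((Real.sqrt (8 * Real.pi * t))⁻¹ ^ 3 *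
        Real.exp (-‖y‖ ^ 2 / (8 * t))) * F y := by
  have hm : Measurable fun ω : PathSpace N => worldLine X ω t i - worldLine X ω t j :=
    ((measurable_pi_apply i).comp (measurable_worldLine X t)).sub
      ((measurable_pi_apply j).comp (measurable_worldLine X t))
  rw [← lintegral_map hF hm, map_pairDiff hij hX ht,
    lintegral_withDensity_eq_lintegral_mul _ (measurable_prod_gaussianPDF_four t) hF]
  refine lintegral_congr fun y => ?_
  rw [Pi.mul_apply, prod_gaussianPDF_four_eq t y]

/-! ### The Markov factorisation for the pair difference -/

/-- The pair difference at time `s` is measurable with respect to the past `σ(b_u : u ≤ s)` of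
the `3N` Brownian coordinates. [folklore] -/
theorem measurable_pairDiff_comap_past {X : Config N} {i j : Fin N} (hX : X i = X j) (s : ℝ≥0) :
    Measurable[MeasurableSpace.comap (fun (ω : PathSpace N) (i : Fin N) (k : Fin 3)
      (u : Set.Iic s) => brownian u (ω i k)) inferInstance]
      fun ω : PathSpace N => worldLine X ω s i - worldLine X ω s j := by
  have h : (fun ω : PathSpace N => worldLine X ω s i - worldLine X ω s j) =
      (fun q : Fin N → Fin 3 → (Set.Iic s → ℝ) => WithLp.toLp 2
        (fun k => Real.sqrt 2 * (q i k ⟨s, Set.mem_Iic.2 le_rfl⟩ - q j k ⟨s, Set.mem_Iic.2 le_rfl⟩))) ∘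
        fun (ω : PathSpace N) (i : Fin N) (k : Fin 3) (u : Set.Iic s) => brownian u (ω i k) := by
    funext ω
    simp only [Function.comp_apply]
    exact pairDiff_eq_toLp hX ω s
  rw [h]
  refine Measurable.comp ?_ (comap_measurable _)
  refine (WithLp.measurable_toLp 2 _).comp (measurable_pi_lambda _ fun k => ?_)
  have hq : ∀ m : Fin N, Measurable fun q : Fin N → Fin 3 → (Set.Iic s → ℝ) =>
      q m k ⟨s, Set.mem_Iic.2 le_rfl⟩ := fun m => by fun_prop
  exact ((hq i).sub (hq j)).const_mul _

/-- **Markov factorisation for the pair difference** (coincident start, `F, H ≥ 0` measurable):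
`E[F(Z_s) H(Z_{s+τ})] = E[F(Z_s) · E'[H(Z_s + Z'_τ)]]`, `Z'` an independent copy: the increment
`Z_{s+τ} − Z_s` is the pair difference of the shifted paths, independent of the past and with the
law of `Z_τ` (`lintegral_comp_pathsShift_eq`). Revuz–Yor (1999), Ch. III §1. [folklore] -/
theorem lintegral_pairDiff_mul_shift {N : ℕ} {X : Config N} {i j : Fin N} (hX : X i = X j)
    (s τ : ℝ≥0)
    {F H : Space → ℝ≥0∞} (hF : Measurable F) (hH : Measurable H) :
    ∫⁻ ω, F (worldLine X ω s i - worldLine X ω s j) *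
        H (worldLine X ω (s + τ) i - worldLine X ω (s + τ) j) ∂wienerPaths N =
      ∫⁻ ω, F (worldLine X ω s i - worldLine X ω s j) *
        ∫⁻ ω', H ((worldLine X ω s i - worldLine X ω s j) +
          (worldLine X ω' τ i - worldLine X ω' τ j)) ∂wienerPaths N ∂wienerPaths N := by
  set G : Space × PathSpace N → ℝ≥0∞ := fun zp => F zp.1 *
    H (zp.1 + WithLp.toLp 2 (fun k => Real.sqrt 2 * (zp.2 i k τ - zp.2 j k τ))) with hGdef
  have hev : ∀ (m : Fin N) (k : Fin 3), Measurable fun p : PathSpace N => p m k τ := fun m k =>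
    (measurable_pi_apply τ).comp ((measurable_pi_apply k).comp (measurable_pi_apply m))
  have hG : Measurable G := by
    refine (hF.comp measurable_fst).mul (hH.comp (measurable_fst.add ?_))
    refine (WithLp.measurable_toLp 2 _).comp (measurable_pi_lambda _ fun k => ?_)
    exact (((hev i k).comp measurable_snd).sub ((hev j k).comp measurable_snd)).const_mul _
  have key := lintegral_comp_pathsShift_eq N s (measurable_pairDiff_comap_past hX s) hG
  have hL : ∀ ω : PathSpace N,
      G (worldLine X ω s i - worldLine X ω s j,
        fun i k u => brownian (s + u) (ω i k) - brownian s (ω i k)) =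
      F (worldLine X ω s i - worldLine X ω s j) *
        H (worldLine X ω (s + τ) i - worldLine X ω (s + τ) j) := by
    intro ω
    simp only [hGdef]
    congr 2
    ext k
    simp only [PiLp.add_apply, pairDiff_apply hX]
    ring
  have hR : ∀ ω ω' : PathSpace N,
      G (worldLine X ω s i - worldLine X ω s j, fun i k u => brownian u (ω' i k)) =
      F (worldLine X ω s i - worldLine X ω s j) * H ((worldLine X ω s i - worldLine X ω s j) +
        (worldLine X ω' τ i - worldLine X ω' τ j)) := by
    intro ω ω'
    simp only [hGdef]
    rw [pairDiff_eq_toLp hX ω' τ]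
  simp_rw [hL, hR] at key
  rw [key]
  refine lintegral_congr fun ω => ?_
  have hm : Measurable fun ω' : PathSpace N => worldLine X ω' τ i - worldLine X ω' τ j :=
    ((measurable_pi_apply i).comp (measurable_worldLine X τ)).sub
      ((measurable_pi_apply j).comp (measurable_worldLine X τ))
  exact lintegral_const_mul (F (worldLine X ω s i - worldLine X ω s j))
    (hH.comp (hm.const_add _))

/-- The pair difference read at real times is jointly measurable in (sample, time). [folklore] -/
theorem measurable_pairDiff_uncurry (X : Config N) (i j : Fin N) :
    Measurable fun p : PathSpace N × ℝ≥0 => worldLine X p.1 p.2 i - worldLine X p.1 p.2 j := by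
  have h : Measurable (Function.uncurry fun (s : ℝ≥0) (ω : PathSpace N) => worldLine X ω s) :=
    measurable_uncurry_of_continuous_of_measurable (continuous_worldLine X) (measurable_worldLine X)
  have h' : Measurable fun p : PathSpace N × ℝ≥0 => worldLine X p.1 p.2 :=
    h.comp (measurable_snd.prodMk measurable_fst)
  exact ((measurable_pi_apply i).comp h').sub ((measurable_pi_apply j).comp h')

end Summit.AtomisticToContinuum.BoseEinsteinCondensation.Theorems.CutLineWitness

end
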